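import Summits.RiemannHypothesis.RiemannHypothesis.Theorems.GroundBartaEvenWinsBeyondArchDeflationPanelQLoc1
import Summits.RiemannHypothesis.RiemannHypothesis.Theorems.GroundBartaEvenWinsBeyondArchDeflationResidualLoc4
import Summits.RiemannHypothesis.RiemannHypothesis.Theorems.GroundBartaEvenWinsBeyondArchDeflationWindowGlue4
import HarnessLib

/-!
# RiemannHypothesis / GroundBarta — rung 4 (`EvenWinsBeyondArch`, stmt-RiemannHypothesis-18807 / 18085):
# the deflated Temple L-side beyond `(log 5)/2`, XIX b′ (four slots) — window bundle `dt_WinL4` and the per-panel bounds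

Helper file (`--supports stmt-RiemannHypothesis-18807`), RH-free, Mathlib + landed tree files only, no facts.  rh-explicit seat
weil-5 (lead ruling R3-8a, 2026-08-22), four-slot twin of the slot-dependent part of prover B's …DeflationPanelQLoc1 (file XIX b′):
* `dt_windowResidual4_panelForm` — the explicit four-slot residual (`dt_windowResidual4`, …WindowGlue4) in panel form;
* `dt_WinL4` — B's window bundle with a fourth slot `(w4, L4, Iw4, IL4, hw4, hL4)` (for `(log 5/√5, log 5)` on the `{2,3,4,5}`-window);
* `dt_bulkCheckL4` (eight flags), `dt_panelLTM4` (on `dt_residualLocTM4`), `dt_tmem_panelLTM4`, `dt_panelQL_bulk4`, `dt_panelQL_split4`.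
The vector bundle `dt_VecL`, the flag lemmas and `dt_splitCheckL` are slot-free and are B's (imported).  Proofs = B's with the
fourth flag pair threaded through.

References: E. Bombieri, Rend. Mat. Acc. Lincei (9) 11 (2000) Thm 2 [Bombieri2000Weil]; Goerisch–Haunhorst (1985)
[GoerischHaunhorst1985]; K. Makino, M. Berz (2003).
-/

set_option linter.dupNamespace false

noncomputable section

open MeasureTheory Set Filter intervalIntegral
open scoped Topology BigOperators

namespace Summit.RiemannHypothesis.RiemannHypothesis.Theorems.EvenWinsBeyondArch

open Literature.NumberTheory.LFunctions
open Literature.Analysis.ValidatedNumerics Literature.Analysis.ValidatedNumerics.PolyMP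
  Literature.Analysis.ValidatedNumerics.NumericsMP Literature.Analysis.ValidatedNumerics.ExpPoly

/-! ## The four-slot residual in panel form -/

section PanelForm4

variable {k : ℕ}

/-- **Panel form.**  With rational stand-ins `M̃`, `W̃` the explicit residual `dt_windowResidual` of the `i`-th vector, evaluated
at `y = y_j + ρ`, is literally the function of `dt_panelBound_bulk` / `_split` / `_edge` with `gp := gp i` and
`pk := dt_killPoly gp M̃ W̃ᵢ i`. [cite: Bombieri2000Weil, Thm 2] -/
theorem dt_windowResidual4_panelForm (c : ℚ) (gp : Fin k → Poly) (w1 L1 w2 L2 w3 L3 w4 L4 : ℝ) (Mt : ℚ)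
    (Wt : Fin k → Fin k → ℚ) (i : Fin k) (y0 : ℚ) (ρ : ℝ) :
    dt_windowResidual4 (c : ℝ) gp w1 L1 w2 L2 w3 L3 w4 L4 (Mt : ℝ) (fun a l ↦ (Wt a l : ℝ)) i ((y0 : ℝ) + ρ) =
      (2 * (∫ x in (-(c : ℝ))..c, Poly.eval (gp i) x * Real.cosh (x / 2)) * Real.cosh (((y0 : ℝ) + ρ) / 2) -
        2 * (∫ x in (-(c : ℝ))..c, Poly.eval (gp i) x * Real.sinh (x / 2)) * Real.sinh (((y0 : ℝ) + ρ) / 2)) +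
      (w1 * (2 * Poly.eval (gp i) ((y0 : ℝ) + ρ) -
          (Icc (-(c : ℝ)) c).indicator (fun x ↦ Poly.eval (gp i) x) (((y0 : ℝ) + ρ) - L1) -
          (Icc (-(c : ℝ)) c).indicator (fun x ↦ Poly.eval (gp i) x) (((y0 : ℝ) + ρ) + L1)) +
        w2 * (2 * Poly.eval (gp i) ((y0 : ℝ) + ρ) -
          (Icc (-(c : ℝ)) c).indicator (fun x ↦ Poly.eval (gp i) x) (((y0 : ℝ) + ρ) - L2) -
          (Icc (-(c : ℝ)) c).indicator (fun x ↦ Poly.eval (gp i) x) (((y0 : ℝ) + ρ) + L2)) +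
        w3 * (2 * Poly.eval (gp i) ((y0 : ℝ) + ρ) -
          (Icc (-(c : ℝ)) c).indicator (fun x ↦ Poly.eval (gp i) x) (((y0 : ℝ) + ρ) - L3) -
          (Icc (-(c : ℝ)) c).indicator (fun x ↦ Poly.eval (gp i) x) (((y0 : ℝ) + ρ) + L3)) +
        w4 * (2 * Poly.eval (gp i) ((y0 : ℝ) + ρ) -
          (Icc (-(c : ℝ)) c).indicator (fun x ↦ Poly.eval (gp i) x) (((y0 : ℝ) + ρ) - L4) -
          (Icc (-(c : ℝ)) c).indicator (fun x ↦ Poly.eval (gp i) x) (((y0 : ℝ) + ρ) + L4))) +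
      ((∫ t in Ioc 0 ((c : ℝ) - ((y0 : ℝ) + ρ)),
          weilArchDensityG t * ((2 * Poly.eval (gp i) ((y0 : ℝ) + ρ) -
            Poly.eval (gp i) ((y0 : ℝ) + ρ - t) - Poly.eval (gp i) ((y0 : ℝ) + ρ + t)) / t)) +
        ∫ t in Ioc ((c : ℝ) - ((y0 : ℝ) + ρ)) ((c : ℝ) + ((y0 : ℝ) + ρ)),
          weilArchDensityG t * ((Poly.eval (gp i) ((y0 : ℝ) + ρ) - Poly.eval (gp i) ((y0 : ℝ) + ρ - t)) / t)) +
      Poly.eval (gp i) ((y0 : ℝ) + ρ) *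
        (weilArchTail ((c : ℝ) - ((y0 : ℝ) + ρ)) + weilArchTail ((c : ℝ) + ((y0 : ℝ) + ρ))) +
      Poly.eval (dt_killPoly gp Mt (Wt i) i) ((y0 : ℝ) + ρ) := by
  rw [dt_windowResidual4, dt_eval_killPoly]
  ring

end PanelForm4

/-! ## Bundles -/

/-- **The window bundle (v2), FOUR prime slots** on the grid `h = c/(2m)`, local degree `Dl`. -/
structure dt_WinL4 (S : ℕ) (c : ℚ) (m Dl : ℕ) where
  /-- slot weights and lengths -/
  w1 : ℝ
  L1 : ℝ
  w2 : ℝ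
  L2 : ℝ
  w3 : ℝ
  L3 : ℝ
  w4 : ℝ
  L4 : ℝ
  /-- panel models of `ρ(t_i + u)` (`1 ≤ i < 2m`; entry `0` unused) with reference polynomials -/
  Dρ : List (IPoly × Poly)
  /-- their moments `∫_{-h}^{h} ρ(t_i+u) u^b du`, `b ≤ Dl` -/
  mu : List (List MI)
  /-- G-moments `∫_0^{2h} G t^j dt` -/
  M0 : List MI
  /-- the panel-0 model of `u ↦ G(h + u)` with reference polynomial (edge panel) -/
  DG0 : IPoly × Poly
  /-- data of the `Ψ̃♮`-kernel model (edge panel): `Qinv`, `eK`, reference `pK` -/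
  Qinv : Poly
  eK : ℕ
  pK : Poly
  /-- `∋ Ψ(2c)`, `log 2 + π/4`, slot enclosures, bracket of `log(2h)` -/
  PsiFar : MI
  C0 : MI
  Iw1 : MI
  IL1 : MI
  Iw2 : MI
  IL2 : MI
  Iw3 : MI
  IL3 : MI
  Iw4 : MI
  IL4 : MI
  llo : ℚ
  lhi : ℚ
  hDρl : Dρ.length = 2 * m
  hDρ : ∀ i : Fin Dρ.length, 1 ≤ (i : ℕ) →
    TMem S (c / (2 * m)) (fun u ↦ weilArchDensity ((PolyMP.panelCentre (c / (2 * m)) i : ℝ) + u)) (Dρ.get i).1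
  hmu : ∀ i, 1 ≤ i → i < 2 * m → ∀ b, b < Dl + 1 →
    MI.mem S (∫ u in (-((c / (2 * m) : ℚ) : ℝ))..((c / (2 * m) : ℚ) : ℝ),
      weilArchDensity (((PolyMP.panelCentre (c / (2 * m)) i : ℚ) : ℝ) + u) * u ^ b) ((mu.getD i []).getD b default)
  hM0 : ∀ j, j < M0.length →
    MI.mem S (∫ t in (0 : ℝ)..(2 * ((c / (2 * m) : ℚ) : ℝ)), weilArchDensityG t * t ^ j) (M0.getD j default)
  hDG0 : TMem S (c / (2 * m)) (fun u ↦ weilArchDensityG (((PolyMP.panelCentre (c / (2 * m)) 0 : ℚ) : ℝ) + u)) DG0.1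
  hFar : MI.mem S (weilArchTail (2 * (c : ℝ))) PsiFar
  hC0 : MI.mem S (Real.log 2 + Real.pi / 4) C0
  hw1 : MI.mem S w1 Iw1
  hL1 : MI.mem S L1 IL1
  hw2 : MI.mem S w2 Iw2
  hL2 : MI.mem S L2 IL2
  hw3 : MI.mem S w3 Iw3
  hL3 : MI.mem S L3 IL3
  hw4 : MI.mem S w4 Iw4
  hL4 : MI.mem S L4 IL4
  hllo : (llo : ℝ) ≤ Real.log (2 * ((c / (2 * m) : ℚ) : ℝ))
  hlhi : Real.log (2 * ((c / (2 * m) : ℚ) : ℝ)) ≤ lhi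
  hlhi0 : lhi ≤ 0

/-- The moments as a function of the panel index. -/
def dt_WinL4.muF {S : ℕ} {c : ℚ} {m Dl : ℕ} (W : dt_WinL4 S c m Dl) : ℕ → List MI := fun i ↦ W.mu.getD i []

section PanelQ4

variable {S : ℕ} {c : ℚ} {m Dl k : ℕ}

/-- The decidable part of a bulk panel (v2): `e^{±y_j/2}` enclosures, the six flags, and enough G-moments for `deg g`. -/
def dt_bulkCheckL4 (S : ℕ) (c : ℚ) (m Dl : ℕ) (W : dt_WinL4 S c m Dl) (g : Poly) (j Ke ke : ℕ) (f1 f2 f3 f4 : Bool × Bool) :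
    Bool :=
  (MI.expPt S Ke ke (ofRat S (PolyMP.panelCentre (c / (2 * m)) j / 2))).isSome &&
  (MI.expPt S Ke ke (ofRat S (-(PolyMP.panelCentre (c / (2 * m)) j / 2)))).isSome &&
  decide (dt_flagMinus S c (c / (2 * m)) (PolyMP.panelCentre (c / (2 * m)) j) W.IL1 = some f1.1) &&
  decide (dt_flagPlus S c (c / (2 * m)) (PolyMP.panelCentre (c / (2 * m)) j) W.IL1 = some f1.2) &&
  decide (dt_flagMinus S c (c / (2 * m)) (PolyMP.panelCentre (c / (2 * m)) j) W.IL2 = some f2.1) &&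
  decide (dt_flagPlus S c (c / (2 * m)) (PolyMP.panelCentre (c / (2 * m)) j) W.IL2 = some f2.2) &&
  decide (dt_flagMinus S c (c / (2 * m)) (PolyMP.panelCentre (c / (2 * m)) j) W.IL3 = some f3.1) &&
  decide (dt_flagPlus S c (c / (2 * m)) (PolyMP.panelCentre (c / (2 * m)) j) W.IL3 = some f3.2) &&
  decide (dt_flagMinus S c (c / (2 * m)) (PolyMP.panelCentre (c / (2 * m)) j) W.IL4 = some f4.1) &&
  decide (dt_flagPlus S c (c / (2 * m)) (PolyMP.panelCentre (c / (2 * m)) j) W.IL4 = some f4.2) &&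
  decide (g.length ≤ W.M0.length + 1)

/-- The v2 Taylor model of the residual of vector `i` on bulk panel `j` with flags `f`. -/
def dt_panelLTM4 (S : ℕ) (c : ℚ) (m Dl K Ke ke : ℕ) (W : dt_WinL4 S c m Dl) (gp : Fin k → Poly) (Mt : ℚ)
    (Wt : Fin k → Fin k → ℚ) (i : Fin k) (V : dt_VecL S c m Dl (gp i)) (j : ℕ) (f1 f2 f3 f4 : Bool × Bool) : IPoly :=
  dt_residualLocTM4 S c m j Dl K (gp i) (dt_killPoly gp Mt (Wt i) i) V.tabF W.Dρ W.muF W.M0 W.PsiFar V.Pc V.Ps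
    (expRatMI S Ke ke (PolyMP.panelCentre (c / (2 * m)) j / 2)) (expRatMI S Ke ke (-(PolyMP.panelCentre (c / (2 * m)) j / 2)))
    (W.Iw1, W.IL1, f1) (W.Iw2, W.IL2, f2) (W.Iw3, W.IL3, f3) (W.Iw4, W.IL4, f4)

/-- **The residual model encloses the explicit residual** (file XVIII c) of vector `i` on bulk panel `j`, given the flag ↔
membership equivalences on the panel (bulk: for all `|ρ| ≤ h`). [cite: Bombieri2000Weil, Thm 2] -/
theorem dt_tmem_panelLTM4 (hS : 0 < S) (hc : 0 < c) (W : dt_WinL4 S c m Dl) (hh1 : 2 * (c / (2 * m)) ≤ 1)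
    (gp : Fin k → Poly) (Mt : ℚ) (Wt : Fin k → Fin k → ℚ) (i : Fin k) (V : dt_VecL S c m Dl (gp i)) {j : ℕ}
    (hjm : j + 2 ≤ m) {K : ℕ} (hK : 0 < K) {Ke ke : ℕ} (f1 f2 f3 f4 : Bool × Bool)
    (he1 : (MI.expPt S Ke ke (ofRat S (PolyMP.panelCentre (c / (2 * m)) j / 2))).isSome = true)
    (he2 : (MI.expPt S Ke ke (ofRat S (-(PolyMP.panelCentre (c / (2 * m)) j / 2)))).isSome = true)
    (hlenM : (gp i).length ≤ W.M0.length + 1) :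
    TMem S (c / (2 * m)) (fun ρ ↦
      (2 * (∫ x in (-(c : ℝ))..c, Poly.eval (gp i) x * Real.cosh (x / 2)) *
          Real.cosh ((((PolyMP.panelCentre (c / (2 * m)) j : ℚ) : ℝ) + ρ) / 2) -
        2 * (∫ x in (-(c : ℝ))..c, Poly.eval (gp i) x * Real.sinh (x / 2)) *
          Real.sinh ((((PolyMP.panelCentre (c / (2 * m)) j : ℚ) : ℝ) + ρ) / 2)) +
      (dt_primeSlotFn (gp i) W.w1 W.L1 f1.1 f1.2 (((PolyMP.panelCentre (c / (2 * m)) j : ℚ) : ℝ) + ρ) +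
        dt_primeSlotFn (gp i) W.w2 W.L2 f2.1 f2.2 (((PolyMP.panelCentre (c / (2 * m)) j : ℚ) : ℝ) + ρ) +
        dt_primeSlotFn (gp i) W.w3 W.L3 f3.1 f3.2 (((PolyMP.panelCentre (c / (2 * m)) j : ℚ) : ℝ) + ρ) +
        dt_primeSlotFn (gp i) W.w4 W.L4 f4.1 f4.2 (((PolyMP.panelCentre (c / (2 * m)) j : ℚ) : ℝ) + ρ)) +
      ((∫ t in Ioc 0 ((c : ℝ) - ((((PolyMP.panelCentre (c / (2 * m)) j : ℚ) : ℝ) + ρ))),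
          weilArchDensityG t * ((2 * Poly.eval (gp i) ((((PolyMP.panelCentre (c / (2 * m)) j : ℚ) : ℝ) + ρ)) -
            Poly.eval (gp i) ((((PolyMP.panelCentre (c / (2 * m)) j : ℚ) : ℝ) + ρ) - t) -
            Poly.eval (gp i) ((((PolyMP.panelCentre (c / (2 * m)) j : ℚ) : ℝ) + ρ) + t)) / t)) +
        ∫ t in Ioc ((c : ℝ) - ((((PolyMP.panelCentre (c / (2 * m)) j : ℚ) : ℝ) + ρ)))
            ((c : ℝ) + ((((PolyMP.panelCentre (c / (2 * m)) j : ℚ) : ℝ) + ρ))),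
          weilArchDensityG t * ((Poly.eval (gp i) ((((PolyMP.panelCentre (c / (2 * m)) j : ℚ) : ℝ) + ρ)) -
            Poly.eval (gp i) ((((PolyMP.panelCentre (c / (2 * m)) j : ℚ) : ℝ) + ρ) - t)) / t)) +
      Poly.eval (gp i) ((((PolyMP.panelCentre (c / (2 * m)) j : ℚ) : ℝ) + ρ)) *
        (weilArchTail ((c : ℝ) - ((((PolyMP.panelCentre (c / (2 * m)) j : ℚ) : ℝ) + ρ))) +
          weilArchTail ((c : ℝ) + ((((PolyMP.panelCentre (c / (2 * m)) j : ℚ) : ℝ) + ρ)))) +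
      Poly.eval (dt_killPoly gp Mt (Wt i) i) ((((PolyMP.panelCentre (c / (2 * m)) j : ℚ) : ℝ) + ρ)))
      (dt_panelLTM4 S c m Dl K Ke ke W gp Mt Wt i V j f1 f2 f3 f4) := by
  have hh2 : c / (2 * m) ≤ 2 := by linarith
  have hM0' : ∀ j', j' + 1 < (gp i).length →
      MI.mem S (∫ t in (0 : ℝ)..(2 * ((c / (2 * m) : ℚ) : ℝ)), weilArchDensityG t * t ^ j') (W.M0.getD j' default) :=
    fun j' hj' ↦ W.hM0 j' (by omega)
  exact dt_tmem_residualLocTM4 hS hc hjm hh2 Dl hK (gp i) (dt_killPoly gp Mt (Wt i) i) V.htab V.htabl W.Dρ W.hDρl W.hDρ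
    W.hmu hM0' W.hFar V.hPc V.hPs (dt_mem_expHalf hS he1) (dt_mem_expNegHalf hS he2)
    (W.Iw1, W.IL1, f1) (W.Iw2, W.IL2, f2) (W.Iw3, W.IL3, f3) (W.Iw4, W.IL4, f4) W.hw1 W.hL1 W.hw2 W.hL2 W.hw3 W.hL3 W.hw4 W.hL4

/-- **Bulk panel (v2).**  For `j + 2 ≤ m`, `2h ≤ 1`, bundles `W`, `V`, and `dt_bulkCheckL` accepting the flags `f`, the explicit
residual of vector `i` satisfies `∫_{-h}^{h} R_i(y_j+ρ)² ≤ sqIntegUpperQ S h (dt_panelLTM …) p` for every reference `p`.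
[cite: Bombieri2000Weil, Thm 2] [cite: GoerischHaunhorst1985, §2] -/
theorem dt_panelQL_bulk4 (hS : 0 < S) (hc : 0 < c) (W : dt_WinL4 S c m Dl) (hh1 : 2 * (c / (2 * m)) ≤ 1)
    (gp : Fin k → Poly) (Mt : ℚ) (Wt : Fin k → Fin k → ℚ) (i : Fin k) (V : dt_VecL S c m Dl (gp i)) {j : ℕ}
    (hjm : j + 2 ≤ m) {K : ℕ} (hK : 0 < K) {Ke ke : ℕ} {f1 f2 f3 f4 : Bool × Bool}
    (hchk : dt_bulkCheckL4 S c m Dl W (gp i) j Ke ke f1 f2 f3 f4 = true)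
    (hRi : IntervalIntegrable (fun ρ ↦
      dt_windowResidual4 (c : ℝ) gp W.w1 W.L1 W.w2 W.L2 W.w3 W.L3 W.w4 W.L4 (Mt : ℝ) (fun a l ↦ (Wt a l : ℝ)) i
        (((PolyMP.panelCentre (c / (2 * m)) j : ℚ) : ℝ) + ρ) ^ 2) volume (-((c / (2 * m) : ℚ) : ℝ)) ((c / (2 * m) : ℚ) : ℝ))
    (p : Poly) :
    ∫ ρ in (-((c / (2 * m) : ℚ) : ℝ))..((c / (2 * m) : ℚ) : ℝ),
        dt_windowResidual4 (c : ℝ) gp W.w1 W.L1 W.w2 W.L2 W.w3 W.L3 W.w4 W.L4 (Mt : ℝ) (fun a l ↦ (Wt a l : ℝ)) i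
          (((PolyMP.panelCentre (c / (2 * m)) j : ℚ) : ℝ) + ρ) ^ 2 ≤
      ((sqIntegUpperQ S (c / (2 * m)) (dt_panelLTM4 S c m Dl K Ke ke W gp Mt Wt i V j f1 f2 f3 f4) p : ℚ) : ℝ) := by
  unfold dt_bulkCheckL4 at hchk
  simp only [Bool.and_eq_true, decide_eq_true_eq] at hchk
  obtain ⟨⟨⟨⟨⟨⟨⟨⟨⟨⟨he1, he2⟩, hf1a⟩, hf1b⟩, hf2a⟩, hf2b⟩, hf3a⟩, hf3b⟩, hf4a⟩, hf4b⟩, hlenM⟩ := hchk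
  have hm : 0 < m := by omega
  have hh0 : 0 ≤ c / (2 * m) := by
    have : (0 : ℚ) < m := by exact_mod_cast hm
    positivity
  have hTM := dt_tmem_panelLTM4 hS hc W hh1 gp Mt Wt i V hjm hK f1 f2 f3 f4 he1 he2 hlenM
  have hTM' : TMem S (c / (2 * m)) (fun ρ ↦
      dt_windowResidual4 (c : ℝ) gp W.w1 W.L1 W.w2 W.L2 W.w3 W.L3 W.w4 W.L4 (Mt : ℝ) (fun a l ↦ (Wt a l : ℝ)) i
        (((PolyMP.panelCentre (c / (2 * m)) j : ℚ) : ℝ) + ρ)) (dt_panelLTM4 S c m Dl K Ke ke W gp Mt Wt i V j f1 f2 f3 f4) := by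
    refine tmem_congr_on hTM fun ρ hρ ↦ ?_
    rw [dt_windowResidual4_panelForm c gp W.w1 W.L1 W.w2 W.L2 W.w3 W.L3 W.w4 W.L4 Mt Wt i _ ρ,
      dt_primeSlotFn_eq_indicator (gp i) W.w1 W.L1 (dt_flagMinus_sound hS hf1a W.hL1 hρ) (dt_flagPlus_sound hS hf1b W.hL1 hρ),
      dt_primeSlotFn_eq_indicator (gp i) W.w2 W.L2 (dt_flagMinus_sound hS hf2a W.hL2 hρ) (dt_flagPlus_sound hS hf2b W.hL2 hρ),
      dt_primeSlotFn_eq_indicator (gp i) W.w3 W.L3 (dt_flagMinus_sound hS hf3a W.hL3 hρ) (dt_flagPlus_sound hS hf3b W.hL3 hρ),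
      dt_primeSlotFn_eq_indicator (gp i) W.w4 W.L4 (dt_flagMinus_sound hS hf4a W.hL4 hρ) (dt_flagPlus_sound hS hf4b W.hL4 hρ)]
  exact integral_sq_le_sqIntegUpperQ hS hh0 hTM' hRi p

/-- **Split panel (v2).**  As `dt_panelQL_bulk`, on a panel containing a switch point `β ∈ [b⁻, b⁺]` with flags `f` on
`(-h, β)` and `f'` on `(β, h)`; error terms localised to the two pieces (`sqIntegSubLocQ`). [cite: Bombieri2000Weil, Thm 2]
[cite: GoerischHaunhorst1985, §2] -/
theorem dt_panelQL_split4 (hS : 0 < S) (hc : 0 < c) (W : dt_WinL4 S c m Dl) (hh1 : 2 * (c / (2 * m)) ≤ 1)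
    (gp : Fin k → Poly) (Mt : ℚ) (Wt : Fin k → Fin k → ℚ) (i : Fin k) (V : dt_VecL S c m Dl (gp i)) {j : ℕ}
    (hjm : j + 2 ≤ m) {K : ℕ} (hK : 0 < K) {Ke ke : ℕ} (f1 f2 f3 f4 f1' f2' f3' f4' : Bool × Bool) {β : ℝ} {bm bp : ℚ}
    (hchk : dt_splitCheckL S c m W.M0.length (gp i) j Ke ke bm bp = true) (hbmβ : (bm : ℝ) ≤ β) (hβbp : β ≤ bp)
    (hflA : ∀ ρ : ℝ, -((c / (2 * m) : ℚ) : ℝ) < ρ → ρ < β →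
      (f1.1 = true ↔ (((PolyMP.panelCentre (c / (2 * m)) j : ℚ) : ℝ) + ρ) - W.L1 ∈ Icc (-(c : ℝ)) c) ∧
      (f1.2 = true ↔ (((PolyMP.panelCentre (c / (2 * m)) j : ℚ) : ℝ) + ρ) + W.L1 ∈ Icc (-(c : ℝ)) c) ∧
      (f2.1 = true ↔ (((PolyMP.panelCentre (c / (2 * m)) j : ℚ) : ℝ) + ρ) - W.L2 ∈ Icc (-(c : ℝ)) c) ∧
      (f2.2 = true ↔ (((PolyMP.panelCentre (c / (2 * m)) j : ℚ) : ℝ) + ρ) + W.L2 ∈ Icc (-(c : ℝ)) c) ∧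
      (f3.1 = true ↔ (((PolyMP.panelCentre (c / (2 * m)) j : ℚ) : ℝ) + ρ) - W.L3 ∈ Icc (-(c : ℝ)) c) ∧
      (f3.2 = true ↔ (((PolyMP.panelCentre (c / (2 * m)) j : ℚ) : ℝ) + ρ) + W.L3 ∈ Icc (-(c : ℝ)) c) ∧
      (f4.1 = true ↔ (((PolyMP.panelCentre (c / (2 * m)) j : ℚ) : ℝ) + ρ) - W.L4 ∈ Icc (-(c : ℝ)) c) ∧
      (f4.2 = true ↔ (((PolyMP.panelCentre (c / (2 * m)) j : ℚ) : ℝ) + ρ) + W.L4 ∈ Icc (-(c : ℝ)) c))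
    (hflB : ∀ ρ : ℝ, β < ρ → ρ < ((c / (2 * m) : ℚ) : ℝ) →
      (f1'.1 = true ↔ (((PolyMP.panelCentre (c / (2 * m)) j : ℚ) : ℝ) + ρ) - W.L1 ∈ Icc (-(c : ℝ)) c) ∧
      (f1'.2 = true ↔ (((PolyMP.panelCentre (c / (2 * m)) j : ℚ) : ℝ) + ρ) + W.L1 ∈ Icc (-(c : ℝ)) c) ∧
      (f2'.1 = true ↔ (((PolyMP.panelCentre (c / (2 * m)) j : ℚ) : ℝ) + ρ) - W.L2 ∈ Icc (-(c : ℝ)) c) ∧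
      (f2'.2 = true ↔ (((PolyMP.panelCentre (c / (2 * m)) j : ℚ) : ℝ) + ρ) + W.L2 ∈ Icc (-(c : ℝ)) c) ∧
      (f3'.1 = true ↔ (((PolyMP.panelCentre (c / (2 * m)) j : ℚ) : ℝ) + ρ) - W.L3 ∈ Icc (-(c : ℝ)) c) ∧
      (f3'.2 = true ↔ (((PolyMP.panelCentre (c / (2 * m)) j : ℚ) : ℝ) + ρ) + W.L3 ∈ Icc (-(c : ℝ)) c) ∧
      (f4'.1 = true ↔ (((PolyMP.panelCentre (c / (2 * m)) j : ℚ) : ℝ) + ρ) - W.L4 ∈ Icc (-(c : ℝ)) c) ∧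
      (f4'.2 = true ↔ (((PolyMP.panelCentre (c / (2 * m)) j : ℚ) : ℝ) + ρ) + W.L4 ∈ Icc (-(c : ℝ)) c))
    (hRi : IntervalIntegrable (fun ρ ↦
      dt_windowResidual4 (c : ℝ) gp W.w1 W.L1 W.w2 W.L2 W.w3 W.L3 W.w4 W.L4 (Mt : ℝ) (fun a l ↦ (Wt a l : ℝ)) i
        (((PolyMP.panelCentre (c / (2 * m)) j : ℚ) : ℝ) + ρ) ^ 2) volume (-((c / (2 * m) : ℚ) : ℝ)) ((c / (2 * m) : ℚ) : ℝ))
    (pA pB : Poly) :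
    ∫ ρ in (-((c / (2 * m) : ℚ) : ℝ))..((c / (2 * m) : ℚ) : ℝ),
        dt_windowResidual4 (c : ℝ) gp W.w1 W.L1 W.w2 W.L2 W.w3 W.L3 W.w4 W.L4 (Mt : ℝ) (fun a l ↦ (Wt a l : ℝ)) i
          (((PolyMP.panelCentre (c / (2 * m)) j : ℚ) : ℝ) + ρ) ^ 2 ≤
      ((sqIntegSubLocQ S (c / (2 * m)) (dt_panelLTM4 S c m Dl K Ke ke W gp Mt Wt i V j f1 f2 f3 f4) pA
          (-(c / (2 * m))) bp : ℚ) : ℝ) +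
        ((sqIntegSubLocQ S (c / (2 * m)) (dt_panelLTM4 S c m Dl K Ke ke W gp Mt Wt i V j f1' f2' f3' f4') pB
          bm (c / (2 * m)) : ℚ) : ℝ) := by
  unfold dt_splitCheckL at hchk
  simp only [Bool.and_eq_true, decide_eq_true_eq] at hchk
  obtain ⟨⟨⟨⟨he1, he2⟩, hbm⟩, hbp⟩, hlenM⟩ := hchk
  have hm : 0 < m := by omega
  have hh0 : 0 ≤ c / (2 * m) := by
    have : (0 : ℚ) < m := by exact_mod_cast hm
    positivity
  have hbp' : ((bp : ℚ) : ℝ) ≤ ((c / (2 * m) : ℚ) : ℝ) := by exact_mod_cast hbp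
  have hbm' : -((c / (2 * m) : ℚ) : ℝ) ≤ bm := by exact_mod_cast hbm
  have hA := dt_tmem_panelLTM4 hS hc W hh1 gp Mt Wt i V hjm hK f1 f2 f3 f4 he1 he2 hlenM
  have hB := dt_tmem_panelLTM4 hS hc W hh1 gp Mt Wt i V hjm hK f1' f2' f3' f4' he1 he2 hlenM
  refine integral_sq_split_le_Ioo_loc hS hh0 hA hB pA pB hbm hbmβ hβbp hbp (fun ρ hρ ↦ ?_) (fun ρ hρ ↦ ?_) hRi
  · obtain ⟨h1a, h1b, h2a, h2b, h3a, h3b, h4a, h4b⟩ := hflA ρ hρ.1 hρ.2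
    simp only [dt_windowResidual4_panelForm c gp W.w1 W.L1 W.w2 W.L2 W.w3 W.L3 W.w4 W.L4 Mt Wt i _ ρ,
      dt_primeSlotFn_eq_indicator (gp i) W.w1 W.L1 h1a h1b, dt_primeSlotFn_eq_indicator (gp i) W.w2 W.L2 h2a h2b,
      dt_primeSlotFn_eq_indicator (gp i) W.w3 W.L3 h3a h3b, dt_primeSlotFn_eq_indicator (gp i) W.w4 W.L4 h4a h4b]
  · obtain ⟨h1a, h1b, h2a, h2b, h3a, h3b, h4a, h4b⟩ := hflB ρ hρ.1 hρ.2
    simp only [dt_windowResidual4_panelForm c gp W.w1 W.L1 W.w2 W.L2 W.w3 W.L3 W.w4 W.L4 Mt Wt i _ ρ,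
      dt_primeSlotFn_eq_indicator (gp i) W.w1 W.L1 h1a h1b, dt_primeSlotFn_eq_indicator (gp i) W.w2 W.L2 h2a h2b,
      dt_primeSlotFn_eq_indicator (gp i) W.w3 W.L3 h3a h3b, dt_primeSlotFn_eq_indicator (gp i) W.w4 W.L4 h4a h4b]

end PanelQ4

end Summit.RiemannHypothesis.RiemannHypothesis.Theorems.EvenWinsBeyondArch

end
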